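import Mathlib.Analysis.Polynomial.Basic
import Summits.Ventures.HSemireg.WedgeHankelRecurrenceGaussLobatto

/-!
# Venture HSemireg — **ZEROS OF A THREE-TERM RECURRENCE WITH POSITIVE `b_j`** (the first half of the finite Favard theorem): if `q_0 = 1`, `q_1 = X − a_0`,
# `q_{n+2} = (X − a_{n+1}) q_{n+1} − b_{n+1} q_n` with all `b_j > 0`, then every `q_n` (`n ≥ 1`) has `n` distinct real zeros `z_0 < ⋯ < z_{n−1}`, at which `q_{n+1}` ALTERNATES:
# `(−1)^{n+i} q_{n+1}(z_i) > 0` — hence the zeros of `q_{n+1}` interlace those of `q_n` (Sturm-type induction; the rightmost zero from the behaviour at `+∞`, the leftmost by division)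

HONEST FRAMING. Part of the Lean index of the computation cell `pub-hsemireg` (seat p10 gen 42, Sunday typer «UNIFORM-IN-n»).  Real polynomials, the intermediate value theorem (N239) and
`Polynomial.tendsto_atTop_of_leadingCoeff_nonneg` only; no variety, no cohomology theory, no sheaf, no Ext group and no semiregularity map is constructed here; nothing here says that HC / HC_CM /
HC_AV holds; no Literature fact (unproved `Prop`) is declared or used.  Custodian versions as in `WedgeHankelSiegelIdeal` (1/3).
SOURCES (cited).  T. S. Chihara, *An Introduction to Orthogonal Polynomials* (1978), Ch. I Thm 5.3 (zeros of an OPS defined by the recurrence with `λ_n > 0` are real, simple and interlace)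
and Thm 4.4 (Favard); G. Szegő, *Orthogonal Polynomials*, Thm 3.3.1–3.3.2; J. Favard, *Sur les polynômes de Tchebicheff*, C. R. Acad. Sci. Paris 200 (1935) 2052–2053.
PROOF TYPED HERE.  Induction on `n` with the invariant «`q_n` has increasing zeros `z` and `(−1)^{n+i} q_{n+1}(z_i) > 0`»: consecutive signs differ, so `q_{n+1}` has a zero in each gap
(N239); `q_{n+1}(z_{n−1}) < 0` and `q_{n+1} → +∞`, so one more zero right of `z_{n−1}`; dividing `q_{n+1}` by these `n` linear factors leaves a monic linear factor `X − r`, and the sign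
of `q_{n+1}(z_0)` forces `r < z_0`.  The new invariant: `q_{n+2}(y_i) = −b_{n+1} q_n(y_i)` at the zeros `y_i` of `q_{n+1}`, and `q_n = ∏(X − z_k)` alternates along `y` because exactly
one `z_k` lies in each gap `(y_i, y_{i+1})`.
DEDUP DISCLOSURE (`rg -n 'recurrence_zeros|favard|Favard' Summits/Ventures/HSemireg Literature`, 2026-09-02): nothing.  The 8 names below: 0 hits tree-wide.

WHAT IS IN THE TREE.  N239 `exists_root_Ioo_of_mul_eval_neg`; N273 `natDegree_sub_lt_of_monic_of_natDegree_eq`; N274 (the recurrence hypotheses' shape); Mathlib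
`Polynomial.tendsto_atTop_of_leadingCoeff_nonneg`, `Multiset.prod_X_sub_C_dvd_iff_le_roots`, `Polynomial.Monic.eq_X_add_C`, `Fin.reverseInduction`, `Fin.snoc`, `Fin.cons`.
THIS FILE (namespace `Summit.Ventures.HSemireg.Wedge.HankelOuter` continued; CHAINED on N278 (import) and N273; 0 definitions):
* §1044 `recurrence_monic_natDegree` (`q_n` monic of degree `n`), `eq_prod_X_sub_C_of_monic_of_roots` (monic of degree `n` with `n` distinct roots is their product),
  `exists_gt_eval_pos_of_monic` (monic of positive degree is eventually positive), `exists_eq_X_sub_C_mul_prod_of_roots` (monic of degree `n + 1` with `n` distinct roots splits off a last real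
  root), `prod_sub_mul_prod_sub_neg_of_interlace` (`∏_k (y_i − z_k)(y_{i+1} − z_k) < 0` when exactly `z_i` lies in `(y_i, y_{i+1})`), `recurrence_zeros_step` (the induction step, WITH the
  interlacing of the new zeros), **`recurrence_zeros`** (THE INVARIANT for every `n ≥ 1`), **`recurrence_zeros_interlace`** (zeros of `q_{n+1}` and `q_n` interlace strictly; product forms).
CAVEATS.  Pure recurrence algebra + IVT; nothing Ext-side.  New names only.
-/

open Module Polynomial Filter
open scoped Matrix Polynomial Topology

namespace Summit.Ventures.HSemireg.Wedge.HankelOuter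

/-! ## §1044. Zeros of a positive three-term recurrence -/

/-- `q_n` is monic of degree `n`. [bookkeeping; this file, §1044] -/
theorem recurrence_monic_natDegree {q : ℕ → ℝ[X]} {a b : ℕ → ℝ} (hq0 : q 0 = 1) (hq1 : q 1 = Polynomial.X - C (a 0))
    (hrec : ∀ n, q (n + 2) = (Polynomial.X - C (a (n + 1))) * q (n + 1) - C (b (n + 1)) * q n) (n : ℕ) : (q n).Monic ∧ (q n).natDegree = n := by
  -- two-step induction
  have key : ∀ n, ((q n).Monic ∧ (q n).natDegree = n) ∧ ((q (n + 1)).Monic ∧ (q (n + 1)).natDegree = n + 1) := by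
    intro n
    induction n with
    | zero =>
      refine ⟨⟨by rw [hq0]; exact monic_one, by rw [hq0, natDegree_one]⟩, ?_, ?_⟩
      · rw [hq1]; exact monic_X_sub_C _
      · rw [hq1, natDegree_X_sub_C]
    | succ n ih =>
      obtain ⟨⟨h0m, h0d⟩, h1m, h1d⟩ := ih
      refine ⟨⟨h1m, h1d⟩, ?_⟩
      have hPm : ((Polynomial.X - C (a (n + 1))) * q (n + 1)).Monic := (monic_X_sub_C _).mul h1m
      have hPd : ((Polynomial.X - C (a (n + 1))) * q (n + 1)).natDegree = n + 2 := by rw [(monic_X_sub_C _).natDegree_mul h1m, natDegree_X_sub_C, h1d]; ring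
      have hlt : (C (b (n + 1)) * q n).degree < ((Polynomial.X - C (a (n + 1))) * q (n + 1)).degree := by
        rw [degree_eq_natDegree hPm.ne_zero, hPd]
        refine lt_of_le_of_lt (degree_mul_le _ _) ?_
        refine lt_of_le_of_lt (add_le_add degree_C_le (degree_le_natDegree)) ?_
        rw [h0d, zero_add]; exact_mod_cast (by omega : n < n + 2)
      rw [show n + 1 + 1 = n + 2 by ring, hrec n]
      refine ⟨hPm.sub_of_left hlt, ?_⟩
      have hd := degree_sub_eq_left_of_degree_lt hlt
      rw [degree_eq_natDegree hPm.ne_zero, hPd] at hd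
      exact natDegree_eq_of_degree_eq_some hd
  exact (key n).1

/-- A monic polynomial of degree `n` vanishing at `n` distinct points is their node polynomial. [bookkeeping; this file, §1044] -/
theorem eq_prod_X_sub_C_of_monic_of_roots {n : ℕ} {p : ℝ[X]} (hpm : p.Monic) (hpd : p.natDegree = n) {z : Fin n → ℝ} (hz : Function.Injective z) (hroot : ∀ i, p.eval (z i) = 0) :
    p = ∏ i, (Polynomial.X - C (z i)) := by
  have hPm : (∏ i, (Polynomial.X - C (z i))).Monic := monic_prod_of_monic _ _ fun i _ => monic_X_sub_C (z i)
  have hPd : (∏ i, (Polynomial.X - C (z i))).natDegree = n := by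
    rw [natDegree_prod_of_monic _ _ fun i _ => monic_X_sub_C (z i)]
    simp only [natDegree_X_sub_C, Finset.sum_const, Finset.card_univ, Fintype.card_fin, smul_eq_mul, mul_one]
  rcases Nat.eq_zero_or_pos n with hn | hn
  · subst hn
    rw [eq_one_of_monic_natDegree_zero hpm hpd, eq_one_of_monic_natDegree_zero hPm hPd]
  · have hlt := natDegree_sub_lt_of_monic_of_natDegree_eq hn hpm hpd hPm hPd
    have hzero : ∀ i, (p - ∏ i, (Polynomial.X - C (z i))).eval (z i) = 0 := fun i => by
      rw [eval_sub, hroot i, eval_prod, Finset.prod_eq_zero (Finset.mem_univ i) (by simp), sub_zero]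
    exact sub_eq_zero.1 (eq_zero_of_natDegree_lt_card_of_eval_eq_zero _ hz hzero (by rw [Fintype.card_fin]; exact hlt))

/-- A monic polynomial of positive degree is positive somewhere to the right of any given point. [`Polynomial.tendsto_atTop_of_leadingCoeff_nonneg`; this file, §1044] -/
theorem exists_gt_eval_pos_of_monic {p : ℝ[X]} (hpm : p.Monic) (hpd : 0 < p.natDegree) (R : ℝ) : ∃ x, R < x ∧ 0 < p.eval x := by
  have ht := Polynomial.tendsto_atTop_of_leadingCoeff_nonneg p (by rw [degree_eq_natDegree hpm.ne_zero]; exact_mod_cast hpd) (by rw [hpm.leadingCoeff]; exact zero_le_one)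
  obtain ⟨x, hx⟩ := ((ht.eventually_gt_atTop 0).and (eventually_gt_atTop R)).exists
  exact ⟨x, hx.2, hx.1⟩

/-- **Splitting off the last root**: a monic polynomial of degree `n + 1` vanishing at `n` distinct points `y_j` is `(X − r) ∏_j (X − y_j)` for a real `r`. [bookkeeping; this file, §1044] -/
theorem exists_eq_X_sub_C_mul_prod_of_roots {n : ℕ} {p : ℝ[X]} (hpm : p.Monic) (hpd : p.natDegree = n + 1) {y : Fin n → ℝ} (hy : Function.Injective y)
    (hroot : ∀ j, p.eval (y j) = 0) : ∃ r : ℝ, p = (Polynomial.X - C r) * ∏ j, (Polynomial.X - C (y j)) := by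
  classical
  set P : ℝ[X] := ∏ j, (Polynomial.X - C (y j)) with hP
  have hPm : P.Monic := monic_prod_of_monic _ _ fun j _ => monic_X_sub_C (y j)
  have hPd : P.natDegree = n := by
    rw [hP, natDegree_prod_of_monic _ _ fun j _ => monic_X_sub_C (y j)]
    simp only [natDegree_X_sub_C, Finset.sum_const, Finset.card_univ, Fintype.card_fin, smul_eq_mul, mul_one]
  -- `P ∣ p`
  have hdvd : P ∣ p := by
    have hroots : (Finset.univ.val.map y) ≤ p.roots := by
      rw [Multiset.le_iff_subset (Multiset.Nodup.map hy Finset.univ.nodup)]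
      intro z hz
      obtain ⟨j, -, rfl⟩ := Multiset.mem_map.1 hz
      exact (mem_roots hpm.ne_zero).2 (hroot j)
    have h := (Multiset.prod_X_sub_C_dvd_iff_le_roots hpm.ne_zero (Finset.univ.val.map y)).2 hroots
    rwa [Multiset.map_map, show ((fun a => Polynomial.X - C a) ∘ y) = fun j => Polynomial.X - C (y j) from rfl, Finset.prod_map_val] at h
  obtain ⟨L, hL⟩ := hdvd
  have hLm : L.Monic := by
    have := hpm; rw [hL] at this; exact hPm.of_mul_monic_left this
  have hLd : L.natDegree = 1 := by
    have := congrArg natDegree hL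
    rw [hPm.natDegree_mul hLm, hpd, hPd] at this; omega
  have hLe : L = Polynomial.X + C (L.coeff 0) := hLm.eq_X_add_C hLd
  refine ⟨-L.coeff 0, ?_⟩
  rw [C_neg, sub_neg_eq_add, hL, mul_comm, ← hLe]

/-- **Exactly one `z` per gap ⇒ alternation**: if `y_0 < ⋯ < y_{m+1}` and `z_0 < ⋯ < z_m` interlace as `y_k < z_k < y_{k+1}`, then `∏_k (y_i − z_k) · ∏_k (y_{i+1} − z_k) < 0` for every
`i ≤ m`. [mechanism; this file, §1044] -/
theorem prod_sub_mul_prod_sub_neg_of_interlace {m : ℕ} {y : Fin (m + 2) → ℝ} {z : Fin (m + 1) → ℝ} (hyz : ∀ k : Fin (m + 1), y k.castSucc < z k ∧ z k < y k.succ) (hy : StrictMono y)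
    (i : Fin (m + 1)) : (∏ k, (y i.castSucc - z k)) * ∏ k, (y i.succ - z k) < 0 := by
  rw [← Finset.prod_mul_distrib, ← Finset.mul_prod_erase _ _ (Finset.mem_univ i)]
  refine mul_neg_of_neg_of_pos (mul_neg_of_neg_of_pos (sub_neg.2 (hyz i).1) (sub_pos.2 (hyz i).2)) (Finset.prod_pos fun k hk => ?_)
  have hki : k ≠ i := (Finset.mem_erase.1 hk).1
  rcases lt_or_gt_of_ne hki with h | h
  · -- `k < i`: `z_k < y_{k+1} ≤ y_i`
    have : y k.succ ≤ y i.castSucc := hy.monotone (Fin.succ_le_castSucc_iff.2 h)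
    exact mul_pos (by linarith [(hyz k).2]) (by linarith [(hyz k).2, hy (Fin.castSucc_lt_succ (i := i))])
  · -- `i < k`: `y_{i+1} ≤ y_k < z_k`
    have : y i.succ ≤ y k.castSucc := hy.monotone (Fin.succ_le_castSucc_iff.2 h)
    exact mul_pos_of_neg_of_neg (by linarith [(hyz k).1, hy (Fin.castSucc_lt_succ (i := i))]) (by linarith [(hyz k).1])

/-- **THE INDUCTION STEP, with interlacing**: if `q_{m+1}` has increasing zeros `z` with `(−1)^{m+1+i} q_{m+2}(z_i) > 0`, then `q_{m+2}` has increasing zeros `y` with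
`(−1)^{m+2+i} q_{m+3}(y_i) > 0` and `y_k < z_k < y_{k+1}` for every `k`. [Chihara I Thm 5.3; this file, §1044] -/
theorem recurrence_zeros_step {q : ℕ → ℝ[X]} {a b : ℕ → ℝ} (hq0 : q 0 = 1) (hq1 : q 1 = Polynomial.X - C (a 0))
    (hrec : ∀ n, q (n + 2) = (Polynomial.X - C (a (n + 1))) * q (n + 1) - C (b (n + 1)) * q n) (hb : ∀ j, 0 < b j) {m : ℕ} {z : Fin (m + 1) → ℝ} (hz : StrictMono z)
    (hzr : ∀ i, (q (m + 1)).eval (z i) = 0) (hzs : ∀ i : Fin (m + 1), 0 < (-1 : ℝ) ^ (m + 1 + (i : ℕ)) * (q (m + 2)).eval (z i)) :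
    ∃ y : Fin (m + 2) → ℝ, StrictMono y ∧ (∀ i, (q (m + 2)).eval (y i) = 0) ∧ (∀ i : Fin (m + 2), 0 < (-1 : ℝ) ^ (m + 2 + (i : ℕ)) * (q (m + 3)).eval (y i)) ∧
      ∀ k : Fin (m + 1), y k.castSucc < z k ∧ z k < y k.succ := by
  obtain ⟨hQm, hQd⟩ := recurrence_monic_natDegree hq0 hq1 hrec (m + 2)
  -- sign alternation of `q_{m+2}` along `z` ⇒ a root in each gap
  have hgap : ∀ k : Fin m, ∃ w, z k.castSucc < w ∧ w < z k.succ ∧ (q (m + 2)).IsRoot w := fun k => by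
    refine exists_root_Ioo_of_mul_eval_neg (hz (Fin.castSucc_lt_succ (i := k))) ?_
    have h1 := hzs k.castSucc; have h2 := hzs k.succ
    rw [Fin.val_castSucc] at h1
    rw [Fin.val_succ, ← add_assoc, pow_succ] at h2
    have hsq : (-1 : ℝ) ^ (m + 1 + (k : ℕ)) * (-1 : ℝ) ^ (m + 1 + (k : ℕ)) = 1 := by rw [← pow_add, ← two_mul, pow_mul, neg_one_sq, one_pow]
    nlinarith [h1, h2, hsq, mul_pos h1 h2]
  choose wg hwg1 hwg2 hwg3 using hgap
  -- one more root right of `z_m`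
  have hlast_neg : (q (m + 2)).eval (z (Fin.last m)) < 0 := by
    have h := hzs (Fin.last m)
    rw [Fin.val_last, show m + 1 + m = 2 * m + 1 by ring, pow_succ, pow_mul, neg_one_sq, one_pow, one_mul] at h
    linarith
  obtain ⟨xR, hxR1, hxR2⟩ := exists_gt_eval_pos_of_monic hQm (by rw [hQd]; omega) (z (Fin.last m))
  obtain ⟨wR, hwR1, hwR2, hwR3⟩ := exists_root_Ioo_of_mul_eval_neg hxR1 (mul_neg_of_neg_of_pos hlast_neg hxR2)
  -- the `m + 1` roots found so far, increasing, all `> z_0`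
  set y' : Fin (m + 1) → ℝ := Fin.snoc wg wR with hy'
  have hy'root : ∀ j, (q (m + 2)).eval (y' j) = 0 := fun j => by
    refine Fin.lastCases ?_ (fun k => ?_) j
    · simp only [hy', Fin.snoc_last]; exact hwR3
    · simp only [hy', Fin.snoc_castSucc]; exact hwg3 k
  have hy'gt : ∀ j, z 0 < y' j := fun j => by
    refine Fin.lastCases ?_ (fun k => ?_) j
    · simp only [hy', Fin.snoc_last]; exact lt_of_le_of_lt (hz.monotone (Fin.zero_le _)) hwR1
    · simp only [hy', Fin.snoc_castSucc]; exact lt_of_le_of_lt (hz.monotone (Fin.zero_le _)) (hwg1 k)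
  have hy'between : ∀ k : Fin m, z k.castSucc < y' k.castSucc ∧ y' k.castSucc < z k.succ := fun k => by
    simp only [hy', Fin.snoc_castSucc]; exact ⟨hwg1 k, hwg2 k⟩
  have hy'last : z (Fin.last m) < y' (Fin.last m) := by simp only [hy', Fin.snoc_last]; exact hwR1
  have hy'mono : StrictMono y' := by
    refine Fin.strictMono_iff_lt_succ.2 fun k => ?_
    have h1 : y' k.castSucc < z k.succ := (hy'between k).2
    -- `y'_{k+1} > z_{k+1}`: either a gap root or the right root
    have h2 : z k.succ < y' k.succ := by
      by_cases hk : k.succ = Fin.last m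
      · rw [hk]; exact hy'last
      · have := hy'between (k.succ.castPred hk)
        rw [Fin.castSucc_castPred] at this
        exact this.1
    exact h1.trans h2
  -- split off the last root, which lies left of `z_0`
  obtain ⟨r, hr⟩ := exists_eq_X_sub_C_mul_prod_of_roots hQm hQd hy'mono.injective hy'root
  have hr0 : r < z 0 := by
    have h := hzs 0
    rw [Fin.val_zero, add_zero, hr, eval_mul, eval_sub, eval_X, eval_C, eval_prod] at h
    -- `∏_j (z_0 − y'_j)` has sign `(−1)^{m+1}`
    have hprod : ∏ j, (Polynomial.X - C (y' j)).eval (z 0) = (-1 : ℝ) ^ (m + 1) * ∏ j, (y' j - z 0) := by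
      rw [show ((-1 : ℝ) ^ (m + 1)) = ∏ _j : Fin (m + 1), (-1 : ℝ) by rw [Finset.prod_const, Finset.card_univ, Fintype.card_fin], ← Finset.prod_mul_distrib]
      exact Finset.prod_congr rfl fun j _ => by rw [eval_sub, eval_X, eval_C]; ring
    have hpos : 0 < ∏ j, (y' j - z 0) := Finset.prod_pos fun j _ => sub_pos.2 (hy'gt j)
    rw [hprod] at h
    have hsq : (-1 : ℝ) ^ (m + 1) * (-1 : ℝ) ^ (m + 1) = 1 := by rw [← pow_add, ← two_mul, pow_mul, neg_one_sq, one_pow]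
    -- `h : 0 < (−1)^{m+1} · ((z_0 − r) · ((−1)^{m+1} · pos))`
    have : 0 < (z 0 - r) * ∏ j, (y' j - z 0) := by nlinarith [h, hsq, hpos]
    exact sub_pos.1 ((pos_iff_pos_of_mul_pos this).2 hpos)
  -- the new zero vector
  set y : Fin (m + 2) → ℝ := Fin.cons r y' with hy
  have hymono : StrictMono y := by
    refine Fin.strictMono_iff_lt_succ.2 fun k => ?_
    refine Fin.cases ?_ (fun k' => ?_) k
    · show y (Fin.castSucc 0) < y (Fin.succ 0)
      rw [Fin.castSucc_zero]
      simp only [hy, Fin.cons_zero, Fin.cons_succ]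
      exact hr0.trans (hy'gt 0)
    · show y k'.succ.castSucc < y k'.succ.succ
      rw [show k'.succ.castSucc = k'.castSucc.succ from Fin.ext rfl]
      simp only [hy, Fin.cons_succ]
      exact hy'mono (Fin.castSucc_lt_succ (i := k'))
  have hyroot : ∀ i, (q (m + 2)).eval (y i) = 0 := fun i => by
    refine Fin.cases ?_ (fun j => ?_) i
    · simp only [hy, Fin.cons_zero]; rw [hr, eval_mul, eval_sub, eval_X, eval_C, sub_self, zero_mul]
    · simp only [hy, Fin.cons_succ]; exact hy'root j
  -- interlacing `y_k < z_k < y_{k+1}`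
  have hinter : ∀ k : Fin (m + 1), y k.castSucc < z k ∧ z k < y k.succ := fun k => by
    constructor
    · refine Fin.cases ?_ (fun k' => ?_) k
      · simp only [hy, Fin.castSucc_zero, Fin.cons_zero]; exact hr0
      · rw [show k'.succ.castSucc = k'.castSucc.succ from Fin.ext rfl]
        simp only [hy, Fin.cons_succ]; exact (hy'between k').2
    · simp only [hy, Fin.cons_succ]
      by_cases hk : k = Fin.last m
      · rw [hk]; exact hy'last
      · have := (hy'between (k.castPred hk)).1
        rwa [Fin.castSucc_castPred] at this
  -- `q_{m+1} = ∏ (X − z_k)` alternates along `y`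
  obtain ⟨hPm, hPd⟩ := recurrence_monic_natDegree hq0 hq1 hrec (m + 1)
  have hprodform := eq_prod_X_sub_C_of_monic_of_roots hPm hPd hz.injective hzr
  have hT : ∀ i : Fin (m + 2), (q (m + 1)).eval (y i) = ∏ k, (y i - z k) := fun i => by
    rw [hprodform, eval_prod]; exact Finset.prod_congr rfl fun k _ => by rw [eval_sub, eval_X, eval_C]
  have hTlast : 0 < (q (m + 1)).eval (y (Fin.last (m + 1))) := by
    rw [hT]; exact Finset.prod_pos fun k _ => sub_pos.2 (lt_of_lt_of_le (hinter k).2 (hymono.monotone (Fin.le_last _)))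
  have hTalt : ∀ i : Fin (m + 1), (q (m + 1)).eval (y i.castSucc) * (q (m + 1)).eval (y i.succ) < 0 := fun i => by
    rw [hT, hT]; exact prod_sub_mul_prod_sub_neg_of_interlace hinter hymono i
  have hU : ∀ i : Fin (m + 2), 0 < (-1 : ℝ) ^ (m + 1 + (i : ℕ)) * (q (m + 1)).eval (y i) := fun i => by
    refine Fin.reverseInduction (motive := fun i : Fin (m + 2) => 0 < (-1 : ℝ) ^ (m + 1 + (i : ℕ)) * (q (m + 1)).eval (y i)) ?_ (fun j hj => ?_) i
    · rw [Fin.val_last, show m + 1 + (m + 1) = 2 * (m + 1) by ring, pow_mul, neg_one_sq, one_pow, one_mul]; exact hTlast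
    · have halt := hTalt j
      rw [Fin.val_succ, ← add_assoc, pow_succ] at hj
      rw [Fin.val_castSucc]
      have hsq : (-1 : ℝ) ^ (m + 1 + (j : ℕ)) * (-1 : ℝ) ^ (m + 1 + (j : ℕ)) = 1 := by rw [← pow_add, ← two_mul, pow_mul, neg_one_sq, one_pow]
      nlinarith [hj, halt, hsq, mul_pos hj hj]
  refine ⟨y, hymono, hyroot, fun i => ?_, hinter⟩
  -- `q_{m+3}(y_i) = −b_{m+2} q_{m+1}(y_i)`
  have hq3 : q (m + 3) = (Polynomial.X - C (a (m + 2))) * q (m + 2) - C (b (m + 2)) * q (m + 1) := hrec (m + 1)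
  rw [hq3, eval_sub, eval_mul, eval_mul, eval_C, hyroot i, mul_zero, zero_sub, show m + 2 + (i : ℕ) = (m + 1 + (i : ℕ)) + 1 by ring, pow_succ]
  have := hU i
  have hbpos := hb (m + 2)
  nlinarith [mul_pos this hbpos]

/-- **THE INVARIANT**: for every `m`, `q_{m+1}` has strictly increasing zeros `z_0 < ⋯ < z_m` and `(−1)^{m+1+i} q_{m+2}(z_i) > 0` for all `i`. [Chihara I Thm 5.3; this file, §1044] -/
theorem recurrence_zeros {q : ℕ → ℝ[X]} {a b : ℕ → ℝ} (hq0 : q 0 = 1) (hq1 : q 1 = Polynomial.X - C (a 0))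
    (hrec : ∀ n, q (n + 2) = (Polynomial.X - C (a (n + 1))) * q (n + 1) - C (b (n + 1)) * q n) (hb : ∀ j, 0 < b j) (m : ℕ) :
    ∃ z : Fin (m + 1) → ℝ, StrictMono z ∧ (∀ i, (q (m + 1)).eval (z i) = 0) ∧ ∀ i : Fin (m + 1), 0 < (-1 : ℝ) ^ (m + 1 + (i : ℕ)) * (q (m + 2)).eval (z i) := by
  induction m with
  | zero =>
    refine ⟨fun _ => a 0, fun i j hij => absurd (Fin.lt_def.1 hij) (by have := i.2; have := j.2; omega), fun i => by rw [hq1]; simp, fun i => ?_⟩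
    rw [Fin.val_eq_zero i, add_zero, hrec 0, hq1, hq0]
    simp only [eval_sub, eval_mul, eval_X, eval_C, eval_one, sub_self, zero_add, mul_zero, zero_sub, pow_one]
    have := hb 1; nlinarith
  | succ m ih =>
    obtain ⟨z, hz, hzr, hzs⟩ := ih
    obtain ⟨y, hy, hyr, hys, -⟩ := recurrence_zeros_step hq0 hq1 hrec hb hz hzr hzs
    exact ⟨y, hy, hyr, hys⟩

/-- **THE ZEROS OF `q_{m+2}` AND `q_{m+1}` INTERLACE**: there are strictly increasing zero vectors `z` of `q_{m+1}` and `y` of `q_{m+2}` with `y_k < z_k < y_{k+1}`, and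
`q_{m+1} = ∏(X − z_k)`, `q_{m+2} = ∏(X − y_k)`. [Chihara I Thm 5.3; Szegő Thm 3.3.2; this file, §1044] -/
theorem recurrence_zeros_interlace {q : ℕ → ℝ[X]} {a b : ℕ → ℝ} (hq0 : q 0 = 1) (hq1 : q 1 = Polynomial.X - C (a 0))
    (hrec : ∀ n, q (n + 2) = (Polynomial.X - C (a (n + 1))) * q (n + 1) - C (b (n + 1)) * q n) (hb : ∀ j, 0 < b j) (m : ℕ) :
    ∃ (z : Fin (m + 1) → ℝ) (y : Fin (m + 2) → ℝ), StrictMono z ∧ StrictMono y ∧ q (m + 1) = ∏ k, (Polynomial.X - C (z k)) ∧ q (m + 2) = ∏ k, (Polynomial.X - C (y k)) ∧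
      ∀ k : Fin (m + 1), y k.castSucc < z k ∧ z k < y k.succ := by
  obtain ⟨z, hz, hzr, hzs⟩ := recurrence_zeros hq0 hq1 hrec hb m
  obtain ⟨y, hy, hyr, -, hyz⟩ := recurrence_zeros_step hq0 hq1 hrec hb hz hzr hzs
  obtain ⟨hPm, hPd⟩ := recurrence_monic_natDegree hq0 hq1 hrec (m + 1)
  obtain ⟨hQm, hQd⟩ := recurrence_monic_natDegree hq0 hq1 hrec (m + 2)
  exact ⟨z, y, hz, hy, eq_prod_X_sub_C_of_monic_of_roots hPm hPd hz.injective hzr, eq_prod_X_sub_C_of_monic_of_roots hQm hQd hy.injective hyr, hyz⟩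

end Summit.Ventures.HSemireg.Wedge.HankelOuter
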